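import Mathlib
import HarnessLib
import Summits.HubbardSuperconductivity.HubbardSuperconductivity.Theses.ChiralWindow
import Literature.MathematicalPhysics.QuantumLattice.DWaveOrderParameterProofs
import Literature.MathematicalPhysics.QuantumLattice.GroundStateSourceBounds

/-!
# Sketch — crux-ideate stmt-HubbardSuperconductivity-1740 (`ChiralWindow.CwChiralConstruction`), ideator 3

First lemmas of three levers (A ray-to-axis transfer, B generic-μ density dissolution,
C Jensen chiral selection). `sorry` allowed here; A's finite-volume core is proved.
-/

noncomputable section

namespace Summit.HubbardSuperconductivity.HubbardSuperconductivity.Cruxes.CwChiralConstruction.Ideator3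

open Matrix Filter MeasureTheory
open Literature.MathematicalPhysics.QuantumLattice Literature.Probability.LatticeModels
open scoped ComplexOrder Topology Matrix.Norms.L2Operator

/-! ## Lever A — ray-to-axis transfer (two-source support-function inequality) -/

section TwoSource

variable {n : Type*} [Fintype n] [DecidableEq n] [Nonempty n]

/-- **Ray-to-axis transfer, finite volume.** For Hermitian `K` (Hamiltonian), `O₁` (the order
operator whose Koma–Tasaki response is wanted) and `C` (ANY second Hermitian source direction, e.g.
`C = a·O₁ + b·O₂` with `O₂` the partner pair field of the chiral combination), and real `h`, `s`:
the ground state of the two-source Hamiltonian `K - sC` is a trial state for `K - hO₁`, whence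
`[E₀(K) - E₀(K - sC)] - s·Re ω_{K-sC}(C) + h·Re ω_{K-sC}(O₁) ≤ E₀(K) - E₀(K - hO₁)`.
With `Re ω_K(C) = 0` the first bracket is `≥ 0` (tree `groundEnergy_source_le_of_re_eq_zero`) and may be
dropped: the LINEAR ENERGY GAIN along the `O₁`-axis is bounded below by the `O₁`-response measured in
the two-source state, minus `s·Re ω(C)`. [folklore convexity; new in the tree] -/
theorem ray_to_axis_transfer {K O₁ C : Matrix n n ℂ} (hK : K.IsHermitian) (hO₁ : O₁.IsHermitian)
    (hC : C.IsHermitian) (h s : ℝ) :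
    (K.groundEnergy - (K - (s : ℂ) • C).groundEnergy)
        - s * ((K - (s : ℂ) • C).groundStateFunctional C).re
        + h * ((K - (s : ℂ) • C).groundStateFunctional O₁).re
      ≤ K.groundEnergy - (K - (h : ℂ) • O₁).groundEnergy := by
  have hA := isHermitian_sub_real_smul hK hC s
  have hB := isHermitian_sub_real_smul hK hO₁ h
  have key := Matrix.groundEnergy_le_groundStateFunctional_re hA hB
  have hdecomp : K - (h : ℂ) • O₁ = (K - (s : ℂ) • C) + (s : ℂ) • C - (h : ℂ) • O₁ := by abel
  rw [hdecomp, map_sub, map_add, map_smul, map_smul,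
    Matrix.groundStateFunctional_hamiltonian hA] at key
  simp only [Complex.sub_re, Complex.add_re, Complex.ofReal_re, smul_eq_mul,
    Complex.re_ofReal_mul] at key
  rw [hdecomp]
  linarith

end TwoSource

section Torus

/-- The two-source torus Hamiltonian: the tree's `d`-wave-sourced grand-canonical Hubbard torus
`dWaveSourceTorus L U μ h₁ = H - μN - h₁(Δ_d + Δ_d†)` minus a second source `h₂·O₂` (intended:
`O₂ = i(X - X†)` or `X + X†` for the partner pair field `X` of the chiral combination `d + iX`;
any Hermitian `O₂` is allowed). [this sketch] -/
def twoSourceTorus (L : ℕ) [NeZero L] (U μ h₁ h₂ : ℝ)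
    (O₂ : Matrix (Finset (Orb (FermionTorus 2 L))) (Finset (Orb (FermionTorus 2 L))) ℂ) :
    Matrix (Finset (Orb (FermionTorus 2 L))) (Finset (Orb (FermionTorus 2 L))) ℂ :=
  dWaveSourceTorus L U μ h₁ - (h₂ : ℂ) • O₂

/-- **LEVER A — the chirally-sourced `d`-wave response floors the one-source Koma–Tasaki order
parameter.** Fix a direction `(a, b)`, `a, b ≥ 0`, and a family of Hermitian second sources `O₂ L`
with `|Re ω(O₂ L)| ≤ B·L²` in every state. If along the two-source ray `(h₁, h₂) = (a·h, b·h)` the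
`d`-wave pair density of the tracial ground state satisfies, for all `h ∈ (0, h₀)`,
`ε + (a·B_d + b·B/2) ≤ liminf_L Re ω_{L,(ah,bh)}(Δ_d)/L²`, then `ε ≤ dWaveOrderParameter U μ`.
(From `ray_to_axis_transfer` with `O₁ = Δ_d + Δ_d†`, `C = a·O₁ + b·O₂`, `s = h`, the vanishing
`Re ω_{H-μN}(C) = 0` for pair operators, and the tree lever
`le_dWaveOrderParameter_of_le_liminf_energyGain`.) Letting `(a,b) = η(cos θ, sin θ)`, `η ↓ 0`:
`dWaveOrderParameter U μ ≥ liminf_{s↓0} liminf_L Re ω_{L, s(cos θ, sin θ)}(Δ_d)/L²` for EVERY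
`θ ∈ [0, π/2]`. [this sketch; provable now, ~100 lines] -/
theorem dWaveOrderParameter_ge_of_twoSource_ray (U μ : ℝ)
    (O₂ : ∀ L : ℕ, Matrix (Finset (Orb (FermionTorus 2 (L + 1))))
      (Finset (Orb (FermionTorus 2 (L + 1)))) ℂ)
    (hO₂ : ∀ L, (O₂ L).IsHermitian)
    (hO₂pair : ∀ L, ((hubbardTorusWith 2 (L + 1) 1 U μ).groundStateFunctional (O₂ L)).re = 0)
    {B : ℝ} (hB : ∀ (L : ℕ) (A : Matrix (Finset (Orb (FermionTorus 2 (L + 1))))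
      (Finset (Orb (FermionTorus 2 (L + 1)))) ℂ), A.IsHermitian →
        |(A.groundStateFunctional (O₂ L)).re| ≤ B * ((L + 1 : ℕ) : ℝ) ^ 2)
    {a b ε h₀ : ℝ} (ha : 0 ≤ a) (hb : 0 ≤ b) (hh₀ : 0 < h₀)
    (H : ∀ h ∈ Set.Ioo 0 h₀,
      ε + (a * (2 * ∑ e ∈ insert (0 : Site 2) unitSteps, |dWaveFormFactor e / Real.sqrt 2|) + b * B / 2)
        ≤ liminf (fun L : ℕ =>
            ((twoSourceTorus (L + 1) U μ (a * h) (b * h) (O₂ L)).groundStateFunctional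
                (pairField dWaveFormFactor (L + 1))).re / ((L + 1 : ℕ) : ℝ) ^ 2) atTop) :
    ε ≤ dWaveOrderParameter U μ := by
  set Bd : ℝ := 2 * ∑ e ∈ insert (0 : Site 2) unitSteps, |dWaveFormFactor e / Real.sqrt 2| with hBd
  have hBd0 : 0 ≤ Bd := by positivity
  refine le_dWaveOrderParameter_of_le_liminf_energyGain U μ hh₀ fun h hh => ?_
  have hhpos : 0 < h := hh.1
  -- (1) the pointwise (finite-volume) inequality
  have hpt : ∀ L : ℕ,
      ((twoSourceTorus (L + 1) U μ (a * h) (b * h) (O₂ L)).groundStateFunctional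
          (pairField dWaveFormFactor (L + 1))).re / ((L + 1 : ℕ) : ℝ) ^ 2 + -(a * Bd + b * B / 2) ≤
      ((dWaveSourceTorus (L + 1) U μ 0).groundEnergy -
          (dWaveSourceTorus (L + 1) U μ h).groundEnergy) / (2 * h * ((L + 1 : ℕ) : ℝ) ^ 2) := by
    intro L
    set K := hubbardTorusWith 2 (L + 1) 1 U μ with hKdef
    set P := pairField dWaveFormFactor (L + 1) with hPdef
    set O₁ := P + Pᴴ with hO₁def
    set C := (a : ℂ) • O₁ + (b : ℂ) • O₂ L with hCdef
    have hK : K.IsHermitian := isHermitian_hubbardTorusWith (L + 1) 1 U μ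
    have hO₁ : O₁.IsHermitian := isHermitian_pairField_add_conjTranspose (L + 1)
    have hsa : ∀ r : ℝ, IsSelfAdjoint (r : ℂ) := fun r => by
      rw [isSelfAdjoint_iff, Complex.star_def, Complex.conj_ofReal]
    have hC : C.IsHermitian := (hO₁.smul (hsa a)).add ((hO₂ L).smul (hsa b))
    have hA : (K - (h : ℂ) • C).IsHermitian := isHermitian_sub_real_smul hK hC h
    have htwo : twoSourceTorus (L + 1) U μ (a * h) (b * h) (O₂ L) = K - (h : ℂ) • C := by
      ext i j
      simp only [twoSourceTorus, dWaveSourceTorus_eq, hCdef, hO₁def, hPdef, hKdef, Matrix.sub_apply,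
        Matrix.smul_apply, Matrix.add_apply, smul_eq_mul, Complex.ofReal_mul]
      ring
    have hsrc0 : dWaveSourceTorus (L + 1) U μ 0 = K := dWaveSourceTorus_zero (L + 1) U μ
    have hsrch : dWaveSourceTorus (L + 1) U μ h = K - (h : ℂ) • O₁ := dWaveSourceTorus_eq (L + 1) U μ h
    -- the transfer inequality (trial state = ground state of the two-source Hamiltonian)
    have key := ray_to_axis_transfer hK hO₁ hC h h
    -- the first bracket is ≥ 0 (no pair expectation without source)
    have hP0 : K.groundStateFunctional P = 0 :=
      groundStateFunctional_hubbardTorusWith_pairField (g := dWaveFormFactor) (L := L + 1) 1 U μ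
    have hO₁0 : K.groundStateFunctional O₁ = 0 := by
      rw [hO₁def, map_add, groundStateFunctional_conjTranspose, hP0, star_zero, add_zero]
    have h0C : (K.groundStateFunctional C).re = 0 := by
      rw [hCdef, map_add, map_smul, map_smul, hO₁0, smul_zero, zero_add, smul_eq_mul,
        Complex.re_ofReal_mul, hO₂pair L, mul_zero]
    have hbr : 0 ≤ K.groundEnergy - (K - (h : ℂ) • C).groundEnergy := by
      have := groundEnergy_source_le_of_re_eq_zero hK hC h0C h
      linarith
    -- Re ω_A(C) = a Re ω_A(O₁) + b Re ω_A(O₂),  Re ω_A(O₁) = 2 Re ω_A(P)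
    have hωC : ((K - (h : ℂ) • C).groundStateFunctional C).re =
        a * ((K - (h : ℂ) • C).groundStateFunctional O₁).re +
          b * ((K - (h : ℂ) • C).groundStateFunctional (O₂ L)).re := by
      rw [hCdef, map_add, map_smul, map_smul, Complex.add_re, smul_eq_mul, smul_eq_mul,
        Complex.re_ofReal_mul, Complex.re_ofReal_mul]
    have hωO₁ : ((K - (h : ℂ) • C).groundStateFunctional O₁).re =
        2 * ((K - (h : ℂ) • C).groundStateFunctional P).re := by
      rw [hO₁def, map_add, Complex.add_re, groundStateFunctional_conjTranspose_re]; ring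
    -- a priori bounds
    have hPbd : |((K - (h : ℂ) • C).groundStateFunctional P).re| ≤ Bd * ((L + 1 : ℕ) : ℝ) ^ 2 :=
      (abs_re_groundStateFunctional_le_norm hA P).trans (norm_pairField_le dWaveFormFactor (L + 1))
    have hO₂bd := hB L (K - (h : ℂ) • C) hA
    have hL : (0 : ℝ) < ((L + 1 : ℕ) : ℝ) ^ 2 := cast_sq_pos_of_neZero (L + 1)
    set X := ((K - (h : ℂ) • C).groundStateFunctional P).re with hXdef
    set Y := ((K - (h : ℂ) • C).groundStateFunctional (O₂ L)).re with hYdef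
    set n2 := ((L + 1 : ℕ) : ℝ) ^ 2 with hn2
    have hX : X ≤ Bd * n2 := (le_abs_self X).trans hPbd
    have hY : Y ≤ B * n2 := (le_abs_self Y).trans hO₂bd
    have h1 : 0 ≤ h * a * (Bd * n2 - X) := mul_nonneg (mul_nonneg hhpos.le ha) (by linarith)
    have h2 : 0 ≤ h * b * (B * n2 - Y) := mul_nonneg (mul_nonneg hhpos.le hb) (by linarith)
    have hG : 2 * h * X - 2 * h * n2 * (a * Bd + b * B / 2) ≤
        K.groundEnergy - (K - (h : ℂ) • O₁).groundEnergy := by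
      rw [hωC, hωO₁] at key
      nlinarith [key, hbr, h1, h2]
    rw [hsrc0, hsrch, htwo, le_div_iff₀ (by positivity)]
    have : (X / n2 + -(a * Bd + b * B / 2)) * (2 * h * n2) =
        2 * h * X - 2 * h * n2 * (a * Bd + b * B / 2) := by
      field_simp
      ring
    rw [this]
    exact hG
  -- (2) pass to liminf
  have hbddP : ∀ L : ℕ, |((twoSourceTorus (L + 1) U μ (a * h) (b * h) (O₂ L)).groundStateFunctional
      (pairField dWaveFormFactor (L + 1))).re / ((L + 1 : ℕ) : ℝ) ^ 2| ≤ Bd := by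
    intro L
    have hsa : ∀ r : ℝ, IsSelfAdjoint (r : ℂ) := fun r => by
      rw [isSelfAdjoint_iff, Complex.star_def, Complex.conj_ofReal]
    have hA : (twoSourceTorus (L + 1) U μ (a * h) (b * h) (O₂ L)).IsHermitian := by
      unfold twoSourceTorus
      exact (dWaveSourceTorus_isHermitian (L + 1) (isHermitian_hubbardTorusWith (L + 1) 1 U μ) _).sub
        ((hO₂ L).smul (hsa _))
    have hL : (0 : ℝ) < ((L + 1 : ℕ) : ℝ) ^ 2 := cast_sq_pos_of_neZero (L + 1)
    rw [abs_div, abs_of_pos hL, div_le_iff₀ hL]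
    exact (abs_re_groundStateFunctional_le_norm hA _).trans (norm_pairField_le dWaveFormFactor (L + 1))
  have hcob : IsCoboundedUnder (· ≥ ·) atTop (fun L : ℕ =>
      ((twoSourceTorus (L + 1) U μ (a * h) (b * h) (O₂ L)).groundStateFunctional
        (pairField dWaveFormFactor (L + 1))).re / ((L + 1 : ℕ) : ℝ) ^ 2) :=
    isCoboundedUnder_ge_of_eventually_le atTop (x := Bd)
      (Eventually.of_forall fun L => (le_abs_self _).trans (hbddP L))
  have hbdd : IsBoundedUnder (· ≥ ·) atTop (fun L : ℕ =>
      ((twoSourceTorus (L + 1) U μ (a * h) (b * h) (O₂ L)).groundStateFunctional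
        (pairField dWaveFormFactor (L + 1))).re / ((L + 1 : ℕ) : ℝ) ^ 2) :=
    isBoundedUnder_of_eventually_ge (a := -Bd)
      (Eventually.of_forall fun L => (neg_abs_le _).trans' (neg_le_neg (hbddP L)))
  have hlim := liminf_add_const atTop (fun L : ℕ =>
      ((twoSourceTorus (L + 1) U μ (a * h) (b * h) (O₂ L)).groundStateFunctional
        (pairField dWaveFormFactor (L + 1))).re / ((L + 1 : ℕ) : ℝ) ^ 2) (-(a * Bd + b * B / 2)) hcob hbdd
  have step : liminf (fun L : ℕ =>
      ((twoSourceTorus (L + 1) U μ (a * h) (b * h) (O₂ L)).groundStateFunctional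
        (pairField dWaveFormFactor (L + 1))).re / ((L + 1 : ℕ) : ℝ) ^ 2 + -(a * Bd + b * B / 2)) atTop ≤
      liminf (fun L : ℕ => ((dWaveSourceTorus (L + 1) U μ 0).groundEnergy -
          (dWaveSourceTorus (L + 1) U μ h).groundEnergy) / (2 * h * ((L + 1 : ℕ) : ℝ) ^ 2)) atTop := by
    refine liminf_le_liminf (Eventually.of_forall hpt) ?_ ?_
    · refine isBoundedUnder_of_eventually_ge (a := -Bd + -(a * Bd + b * B / 2))
        (Eventually.of_forall fun L => ?_)
      have := (neg_abs_le _).trans' (neg_le_neg (hbddP L))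
      linarith
    · refine isCoboundedUnder_ge_of_eventually_le atTop (x := Bd) (Eventually.of_forall fun L => ?_)
      exact (energyGain_div_le_dWaveSourceDensity U μ hhpos).trans (dWaveSourceDensity_le_const _ U μ h)
  have Hh := H h hh
  rw [hlim] at step
  linarith

/-- The reduction of the crux's ORDER clause to the chirally-sourced staircase (statement shape the
line would take; `O₂`, direction `(a,b)` free). [this sketch] -/
def ChirallySourcedFloor (U μ C : ℝ) : Prop :=
  ∃ (O₂ : ∀ L : ℕ, Matrix (Finset (Orb (FermionTorus 2 (L + 1))))
      (Finset (Orb (FermionTorus 2 (L + 1)))) ℂ) (a b h₀ η : ℝ),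
    0 ≤ a ∧ 0 < b ∧ 0 < h₀ ∧ 0 ≤ η ∧ (∀ L, (O₂ L).IsHermitian) ∧
    ∀ h ∈ Set.Ioo 0 h₀,
      Real.exp (-C / U ^ 2) + η ≤ liminf (fun L : ℕ =>
        ((twoSourceTorus (L + 1) U μ (a * h) (b * h) (O₂ L)).groundStateFunctional
            (pairField dWaveFormFactor (L + 1))).re / ((L + 1 : ℕ) : ℝ) ^ 2) atTop

end Torus

/-! ## Lever B — under `∀U ∃δ` the density clause is free at generic `μ` (Griffiths lemma) -/

section Density

/-- **Griffiths' lemma for the grand-canonical torus density.** If the ground-state energy density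
of `hubbardTorusWith 2 (L+1) 1 U μ` has a thermodynamic limit `e U μ` for every `μ` (it is then
concave in `μ`, being a pointwise limit of the concave `μ ↦ E₀(H - μN)/L²`), then at every `μ₀` where
`e U ·` is differentiable the tracial ground-state densities converge to `-∂_μ e`. Concave functions
are differentiable off a countable set, so the crux's clause (D) holds at all but countably many `μ`
AUTOMATICALLY — usable because THIS crux quantifies `∀U ∃δ ∃μ` (the twin `WcbcsBcsConstruction`,
`∃δ ∀U`, cannot use it). [Griffiths 1964 / Ruelle, Statistical Mechanics §; folklore convex analysis] -/
theorem density_tendsto_of_differentiableAt (U : ℝ) (e : ℝ → ℝ)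
    (hTL : ∀ μ : ℝ, Tendsto (fun L : ℕ =>
      (hubbardTorusWith 2 (L + 1) 1 U μ).groundEnergy / ((L + 1 : ℕ) : ℝ) ^ 2) atTop (𝓝 (e μ)))
    {μ₀ : ℝ} (hdiff : DifferentiableAt ℝ e μ₀) :
    Tendsto (fun L : ℕ => ((hubbardTorusWith 2 (L + 1) 1 U μ₀).groundStateFunctional
      totalNumber).re / ((L + 1 : ℕ) : ℝ) ^ 2) atTop (𝓝 (-(deriv e μ₀))) := by
  sorry

/-- **LEVER B — reduction of the crux to an order floor on a `μ`-window.** Given the thermodynamic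
limit `e U μ` of the grand-canonical ground-state energy density (hypothesis `hTL`, standard but not
yet in the tree for `d = 2`), the crux follows from: for every small `U` there is a nondegenerate
`μ`-interval on which (i) `-∂_μ e(U,·) ∈ [13/25, 7/10]` wherever the derivative exists (at weak
coupling automatic on the free window `μ₀(1-δ)`, `δ ∈ [0.33, 0.45]`, by the `2√(KU)` jump bound for
concave functions `U`-close to a `C^{1,1}` one) and (ii) the order floor holds. [this sketch] -/
theorem cwChiralConstruction_of_window (e : ℝ → ℝ → ℝ)
    (hTL : ∀ U μ : ℝ, Tendsto (fun L : ℕ =>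
      (hubbardTorusWith 2 (L + 1) 1 U μ).groundEnergy / ((L + 1 : ℕ) : ℝ) ^ 2) atTop (𝓝 (e U μ)))
    (hW : ∃ U₀ : ℝ, 0 < U₀ ∧ ∃ C : ℝ, 0 < C ∧ ∀ U ∈ Set.Ioo (0 : ℝ) U₀, ∃ μ₁ μ₂ : ℝ, μ₁ < μ₂ ∧
      (∀ μ ∈ Set.Ioo μ₁ μ₂, DifferentiableAt ℝ (e U) μ →
        -deriv (e U) μ ∈ Set.Icc (13 / 25 : ℝ) (7 / 10)) ∧
      ∀ μ ∈ Set.Ioo μ₁ μ₂, Real.exp (-C / U ^ 2) ≤ dWaveOrderParameter U μ) :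
    Summit.HubbardSuperconductivity.HubbardSuperconductivity.Theses.ChiralWindow.CwChiralConstruction := by
  sorry

end Density

/-! ## Lever C — Jensen/midpoint-concavity selection of the chiral combination at `T = 0` -/

section Jensen

/-- The `T = 0` pair-condensation kernel on an energy shell of half-width `W`:
`Φ_W(x) = ∫_{-W}^{W} (√(ξ² + x) - |ξ|) dξ` (`= W√(W²+x) - W² + x·arsinh(W/√x)`; `Φ_W' (x) ≈ ½ log(4W²/x)`).
It is increasing and CONCAVE in `x = |Δ|² ≥ 0`. The two-channel `T = 0` BCS energy with bottom
eigenfunctions `g₁` (B₁g) and `g₂` (partner) on the Fermi-curve measure `ν` is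
`D₁²/lam₁ + D₂²/lam₂ - ∫ Φ_W(D₁²g₁² + D₂²g₂² + 2D₁D₂ cos χ · g₁g₂) dν`. [BCS 1957 §III; Sigrist–Ueda 1991 §IV] -/
def condensationKernel (W x : ℝ) : ℝ :=
  ∫ ξ in (-W)..W, (Real.sqrt (ξ ^ 2 + x) - |ξ|)

/-- Two-channel `T = 0` BCS energy (amplitudes `D₁, D₂`, relative phase `χ`). [Sigrist–Ueda 1991 §IV.A] -/
def twoChannelBCSEnergy (ν : Measure Momentum) (W lam₁ lam₂ : ℝ) (g₁ g₂ : Momentum → ℝ)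
    (D₁ D₂ χ : ℝ) : ℝ :=
  D₁ ^ 2 / lam₁ + D₂ ^ 2 / lam₂ -
    ∫ k, condensationKernel W
      (D₁ ^ 2 * g₁ k ^ 2 + D₂ ^ 2 * g₂ k ^ 2 + 2 * D₁ * D₂ * Real.cos χ * (g₁ k * g₂ k)) ∂ν

/-- **Symmetric slice maximises a concave functional (midpoint concavity + a reflection).**
If `Φ` is concave on `[0, ∞)`, `σ` preserves `ν`, `A ∘ σ = A ≥ |B|` and `B ∘ σ = -B`, then
`∫ Φ(A + tB) dν ≤ ∫ Φ(A) dν` for `|t| ≤ 1`:  `Φ(A+tB) + Φ(A-tB) ≤ 2Φ(A)` pointwise and the two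
integrals on the left agree by `σ`. [folklore; this sketch] -/
theorem integral_concave_le_symmetric_slice {α : Type*} [MeasurableSpace α] (ν : Measure α)
    [IsFiniteMeasure ν] (Φ : ℝ → ℝ) (hΦ : ConcaveOn ℝ (Set.Ici 0) Φ) (hΦc : ContinuousOn Φ (Set.Ici 0))
    (σ : α → α) (hσ : MeasurePreserving σ ν ν)
    (A B : α → ℝ) (hAm : Measurable A) (hBm : Measurable B)
    (hAbdd : ∃ M, ∀ x, A x ≤ M) (hA : ∀ x, A (σ x) = A x) (hB : ∀ x, B (σ x) = -B x)
    (hdom : ∀ x, |B x| ≤ A x) {t : ℝ} (ht : |t| ≤ 1) :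
    ∫ x, Φ (A x + t * B x) ∂ν ≤ ∫ x, Φ (A x) ∂ν := by
  sorry

/-- **LEVER C, first lemma — relative phase `±π/2` by concavity.** If a `ν`-preserving map `σ` of
momentum space flips `g₁` and fixes `g₂` (a lattice reflection separating the two `D₄` channels),
then for all amplitudes and every relative phase `χ` the two-channel `T = 0` BCS energy is minimised
on the time-reversal-breaking slice `χ = π/2`:  `E(D₁,D₂,π/2) ≤ E(D₁,D₂,χ)`. (Sigrist–Ueda / Frank–Lemm
prove the near-`T_c` Ginzburg–Landau version from the sign of the quartic cross term; at `T = 0` it is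
two lines from `integral_concave_le_symmetric_slice` with `A = D₁²g₁² + D₂²g₂²`, `B = 2D₁D₂g₁g₂`.)
[this sketch] -/
theorem twoChannel_relativePhase (ν : Measure Momentum) [IsFiniteMeasure ν] {W lam₁ lam₂ : ℝ} (hW : 0 < W)
    (g₁ g₂ : Momentum → ℝ) (hg₁ : Measurable g₁) (hg₂ : Measurable g₂)
    (hbdd : ∃ M, ∀ k, |g₁ k| ≤ M ∧ |g₂ k| ≤ M)
    (σ : Momentum → Momentum) (hσ : MeasurePreserving σ ν ν)
    (h₁ : ∀ k, g₁ (σ k) = -g₁ k) (h₂ : ∀ k, g₂ (σ k) = g₂ k) (D₁ D₂ χ : ℝ) :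
    twoChannelBCSEnergy ν W lam₁ lam₂ g₁ g₂ D₁ D₂ (Real.pi / 2) ≤
      twoChannelBCSEnergy ν W lam₁ lam₂ g₁ g₂ D₁ D₂ χ := by
  sorry

/-- The **chirality index** of an ordered pair of channel eigenfunctions on the Fermi-curve measure:
`J(g₁; g₂) = ∫ log(1/g₁²)·(g₂² - g₁²) dν` (with `∫g₁² dν = ∫g₂² dν`). Node covering pushes `J` up:
`g₂²` is large exactly where `log(1/g₁²)` is. Circular `d ± id'` (`√2 cos 2φ`, `√2 sin 2φ`): `J = 2`.
[this sketch; cf. Vojta–Zhang–Sachdev 2000 (finite threshold for `d → d + iX` at `T = 0`)] -/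
def chiralityIndex (ν : Measure Momentum) (g₁ g₂ : Momentum → ℝ) : ℝ :=
  ∫ k, Real.log (1 / g₁ k ^ 2) * (g₂ k ^ 2 - g₁ k ^ 2) ∂ν

/-- **LEVER C, second lemma — the leading-log secondary-instability identity.** With the leading-log
kernel slope `Φ'(y) = ½(Λ - log y)` (`Λ = log 4W²`), the `x₂ = D₂²`-derivative of the two-channel energy
at the pure-`g₁` state `(x₁, 0, π/2)` is `1/lam₂ - ½∫(Λ - log(x₁g₁²)) g₂² dν`, and subtracting the pure-state
stationarity `1/lam₁ = ½∫(Λ - log(x₁g₁²)) g₁² dν` leaves the `x₁`-INDEPENDENT quantity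
`(1/lam₂ - 1/lam₁) - ½ J(g₁; g₂)` when `∫g₁² = ∫g₂²`:  coexistence (the chiral window is open on the
`g₁`-dominant side) iff `1/lam₂ - 1/lam₁ < ½ J`, and AT the Kohn–Luttinger crossing `lam₁ = lam₂` iff `J > 0`.
Stated as the algebraic identity. [this sketch] -/
theorem secondaryInstability_identity (ν : Measure Momentum) [IsFiniteMeasure ν] (g₁ g₂ : Momentum → ℝ)
    (Λ x₁ : ℝ) (hx₁ : 0 < x₁)
    (hnorm : ∫ k, g₁ k ^ 2 ∂ν = ∫ k, g₂ k ^ 2 ∂ν)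
    (hint₁ : Integrable (fun k => Real.log (g₁ k ^ 2) * g₁ k ^ 2) ν)
    (hint₂ : Integrable (fun k => Real.log (g₁ k ^ 2) * g₂ k ^ 2) ν)
    (hsq₁ : Integrable (fun k => g₁ k ^ 2) ν) (hsq₂ : Integrable (fun k => g₂ k ^ 2) ν)
    (hae : ∀ᵐ k ∂ν, g₁ k ≠ 0) :
    (∫ k, (1 / 2) * (Λ - Real.log (x₁ * g₁ k ^ 2)) * g₂ k ^ 2 ∂ν) -
        (∫ k, (1 / 2) * (Λ - Real.log (x₁ * g₁ k ^ 2)) * g₁ k ^ 2 ∂ν) =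
      (1 / 2) * chiralityIndex ν g₁ g₂ := by
  sorry

/-- The crux-facing shape of Lever C (informal target of the line, recorded as a `Prop`): on the
certified window of `CwKLChiralWindow` the chirality indices of (B₁g; partner) and (partner; B₁g) are
both positive — the `T = 0` two-channel problem is TETRACRITICAL (coexistence wedge of width `∝ U²` in
doping around the crossing line), not a first-order flop. For the 2-dimensional irrep `E` replace `g₂²`
by `Σᵢ fᵢ²`. [this sketch] -/
def ChiralityIndicesPositive : Prop :=
  ∃ a b : ℝ, 3 / 10 ≤ a ∧ a < b ∧ b ≤ 12 / 25 ∧ ∃ j : ℝ, 0 < j ∧ ∀ δ ∈ Set.Icc a b,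
    let ε : Momentum → ℝ := squareDispersion 1 0
    let μ : ℝ := chemicalPotentialOfDensity ε (1 - δ)
    ∃ (g : Momentum → ℝ) (n : ℕ) (f : Fin n → Momentum → ℝ),
      IsChannelState ε μ D4Irrep.B1g g ∧
      (∫ k, g k ^ 2 ∂fermiCurveMeasure ε μ) = ∫ k, (∑ i, f i k ^ 2) ∂fermiCurveMeasure ε μ ∧
      j ≤ ∫ k, Real.log (1 / g k ^ 2) * ((∑ i, f i k ^ 2) - g k ^ 2) ∂fermiCurveMeasure ε μ ∧
      j ≤ ∫ k, Real.log (1 / ∑ i, f i k ^ 2) * (g k ^ 2 - ∑ i, f i k ^ 2) ∂fermiCurveMeasure ε μ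

end Jensen

end Summit.HubbardSuperconductivity.HubbardSuperconductivity.Cruxes.CwChiralConstruction.Ideator3

end
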